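import Mathlib
import HarnessLib.Audit
import Summits.PneNP.PneNP.Theorems.PstarCoreBound

/-!
# The sharing bound for XOR-closed expanding families (ROUND-24, memo `CORE-BOUND-NOTES.md` §12.1; planner seat p3 g20)

FRONTIER range-avoidance ladder, rung F-N3, ROUND 24 (cell `pnp-ideate`; restricted-model proof complexity — nothing here bears on
`P` versus `NP`).

Step R0 of the proof plan for `PstarCoreShape.CoreShape` (memo §13).  For an XOR-closed family `J₀` (no XOR variable of a member is a
boundary variable of `J₀`) every boundary variable of `J₀` is the variable of an AND slot `(f, s)`, `f ∈ J₀`, `s ∈ {2,3}`, that is NOT shared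
(its variable occurs in exactly one member).  Hence `#bdry J₀ + #sharedSlots J₀ ≤ 2·#J₀`, and if `J₀` is `3/2`-boundary-expanding
(`3·#J₀ ≤ 2·#bdry J₀`) then **at most half of the members' worth of AND slots are shared: `2·#sharedSlots ≤ #J₀`**.  Consequences used in the
memo: a core with `k ≤ 3` members has no AND sharing at all, `k ≤ 5` at most one variable on two members, `k ≤ 7` one variable on at most three
members, and two distinct shared variables need `k ≥ 8` (§12.1; this is what makes the systematic kit enumeration K18 finite for `k ≤ 7`).

Everything here is PROVED (no conjecture tags).
-/

set_option linter.dupNamespace false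

open Finset Literature.Computability.Complexity
open Summit.PneNP.PneNP.Theorems.PstarTyped (Typed)
open Summit.PneNP.PneNP.Theorems.PstarSALevel (varSet bdry)
open Summit.PneNP.PneNP.Theorems.PstarCoreBound (XorClosed)

namespace Summit.PneNP.PneNP.Theorems.PstarSharingBound

variable {n m : ℕ}

/-- Multiplicity of a variable in a family: the number of members whose variable set contains it. -/
def mult (I : LocalMap 4 n m) (J₀ : Finset (Fin m)) (v : Fin n) : ℕ :=
  (J₀.filter fun j => v ∈ varSet I j).card

/-- The AND slots of a family: pairs `(f, s)` with `f ∈ J₀` and `s ∈ {2, 3}`. -/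
def andSlots (J₀ : Finset (Fin m)) : Finset (Fin m × Fin 4) :=
  J₀ ×ˢ (univ.filter fun s : Fin 4 => 2 ≤ s.val)

/-- The SHARED AND slots of a family: AND slots whose variable occurs in at least two members. -/
def sharedSlots (I : LocalMap 4 n m) (J₀ : Finset (Fin m)) : Finset (Fin m × Fin 4) :=
  (andSlots J₀).filter fun p => 2 ≤ mult I J₀ (I.vars p.1 p.2)

/-- There are exactly two AND slots per member. -/
theorem card_andSlots (J₀ : Finset (Fin m)) : (andSlots J₀).card = 2 * J₀.card := by
  have h4 : (univ.filter fun s : Fin 4 => 2 ≤ s.val).card = 2 := by decide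
  rw [andSlots, card_product, h4, Nat.mul_comm]

/-- Shared slots are AND slots. -/
theorem sharedSlots_subset (I : LocalMap 4 n m) (J₀ : Finset (Fin m)) : sharedSlots I J₀ ⊆ andSlots J₀ :=
  filter_subset _ _

/-- A boundary variable has multiplicity one. -/
theorem mult_eq_one_of_mem_bdry {I : LocalMap 4 n m} {J₀ : Finset (Fin m)} {v : Fin n} (hv : v ∈ bdry I J₀) :
    mult I J₀ v = 1 := by
  unfold bdry at hv
  simpa [mult] using hv

/-- In an XOR-closed family every boundary variable is the variable of a non-shared AND slot. -/
theorem bdry_subset_image (I : LocalMap 4 n m) (J₀ : Finset (Fin m)) (hX : XorClosed I J₀) :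
    bdry I J₀ ⊆ (andSlots J₀ \ sharedSlots I J₀).image fun p => I.vars p.1 p.2 := by
  intro v hv
  have h1 : mult I J₀ v = 1 := mult_eq_one_of_mem_bdry hv
  -- a member containing `v`
  have hne : (J₀.filter fun j => v ∈ varSet I j).Nonempty := by
    rw [← card_pos]; unfold mult at h1; omega
  obtain ⟨j, hj⟩ := hne
  rw [mem_filter] at hj
  obtain ⟨hjJ, hvj⟩ := hj
  -- `v = I.vars j s` for some slot `s`, which must be an AND slot by XOR-closedness
  unfold varSet at hvj
  rw [mem_image] at hvj
  obtain ⟨s, -, hs⟩ := hvj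
  have hs2 : 2 ≤ s.val := by
    by_contra hlt
    push Not at hlt
    exact hX j hjJ s hlt (hs ▸ hv)
  rw [mem_image]
  refine ⟨(j, s), ?_, hs⟩
  rw [mem_sdiff]
  refine ⟨?_, ?_⟩
  · unfold andSlots
    rw [mem_product, mem_filter]
    exact ⟨hjJ, mem_univ _, hs2⟩
  · unfold sharedSlots
    rw [mem_filter]
    push Not
    intro _
    show mult I J₀ (I.vars j s) < 2
    rw [hs, h1]; omega

/-- **Slot count**: boundary variables plus shared AND slots number at most `2·#J₀` for an XOR-closed family. -/
theorem card_bdry_add_card_sharedSlots_le (I : LocalMap 4 n m) (J₀ : Finset (Fin m)) (hX : XorClosed I J₀) :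
    (bdry I J₀).card + (sharedSlots I J₀).card ≤ 2 * J₀.card := by
  have h1 : (bdry I J₀).card ≤ (andSlots J₀ \ sharedSlots I J₀).card :=
    (card_le_card (bdry_subset_image I J₀ hX)).trans card_image_le
  have h2 : (andSlots J₀ \ sharedSlots I J₀).card = (andSlots J₀).card - (sharedSlots I J₀).card :=
    card_sdiff_of_subset (sharedSlots_subset I J₀)
  have h3 : (sharedSlots I J₀).card ≤ (andSlots J₀).card := card_le_card (sharedSlots_subset I J₀)
  have h4 := card_andSlots J₀
  omega

/-- **The sharing bound (memo §12.1, R0 of the CoreShape plan)**: an XOR-closed `3/2`-boundary-expanding family has at most `#J₀ / 2`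
shared AND slots. -/
theorem two_mul_card_sharedSlots_le (I : LocalMap 4 n m) (J₀ : Finset (Fin m)) (hX : XorClosed I J₀)
    (hB : 3 * J₀.card ≤ 2 * (bdry I J₀).card) : 2 * (sharedSlots I J₀).card ≤ J₀.card := by
  have := card_bdry_add_card_sharedSlots_le I J₀ hX
  omega

/-- Corollary: on a typed instance, an XOR-closed expanding family with at most three members has NO shared AND slot (a shared slot
comes with a second one holding the same variable, and `2·2 ≤ 3` fails). -/
theorem sharedSlots_eq_empty_of_card_le_three (I : LocalMap 4 n m) (hT : Typed I) (J₀ : Finset (Fin m)) (hX : XorClosed I J₀)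
    (hB : 3 * J₀.card ≤ 2 * (bdry I J₀).card) (h3 : J₀.card ≤ 3) : sharedSlots I J₀ = ∅ := by
  have h := two_mul_card_sharedSlots_le I J₀ hX hB
  by_contra hne
  obtain ⟨p, hp⟩ := nonempty_iff_ne_empty.mpr hne
  have hp' := hp
  unfold sharedSlots at hp'
  rw [mem_filter] at hp'
  obtain ⟨hpA, hmult⟩ := hp'
  have hpA' := hpA
  unfold andSlots at hpA'
  rw [mem_product, mem_filter] at hpA'
  obtain ⟨hpJ, -, hp2⟩ := hpA'
  -- a second member `j' ≠ p.1` containing the variable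
  have hex : ∃ j' ∈ J₀, j' ≠ p.1 ∧ I.vars p.1 p.2 ∈ varSet I j' := by
    by_contra hno
    push Not at hno
    have hsub : (J₀.filter fun j => I.vars p.1 p.2 ∈ varSet I j) ⊆ {p.1} := by
      intro j hj
      rw [mem_filter] at hj
      rw [mem_singleton]
      by_contra hne'
      exact hno j hj.1 hne' hj.2
    have := card_le_card hsub
    unfold mult at hmult
    rw [card_singleton] at this
    omega
  obtain ⟨j', hj'J, hj'ne, hvj'⟩ := hex
  unfold varSet at hvj'
  rw [mem_image] at hvj'
  obtain ⟨s', -, hs'⟩ := hvj'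
  -- by `Typed`, the second occurrence is again an AND slot
  have hs2 : 2 ≤ s'.val := by
    by_contra hlt
    push Not at hlt
    exact hT j' p.1 s' p.2 hlt hp2 hs'
  have hq : (j', s') ∈ sharedSlots I J₀ := by
    unfold sharedSlots
    rw [mem_filter]
    refine ⟨?_, ?_⟩
    · unfold andSlots; rw [mem_product, mem_filter]; exact ⟨hj'J, mem_univ _, hs2⟩
    · show 2 ≤ mult I J₀ (I.vars j' s')
      rw [hs']; exact hmult
  have hpq : p ≠ (j', s') := by
    intro hEq; apply hj'ne; rw [hEq]
  have h2 : 2 ≤ (sharedSlots I J₀).card := by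
    have hsub : ({p, (j', s')} : Finset (Fin m × Fin 4)) ⊆ sharedSlots I J₀ := by
      intro q hq'
      rw [mem_insert, mem_singleton] at hq'
      rcases hq' with rfl | rfl
      · exact hp
      · exact hq
    have := card_le_card hsub
    rwa [card_pair hpq] at this
  omega

end Summit.PneNP.PneNP.Theorems.PstarSharingBound
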